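import Mathlib
import Summits.Ventures.HodgeRepro2.Hypothesis
import Summits.Ventures.HodgeRepro2.BallActionU21
import Summits.Ventures.HodgeRepro2.FrameEmbedding
import Summits.Ventures.HodgeRepro2.BallGroup
import Summits.Ventures.HodgeRepro2.BallLines
import Summits.Ventures.HodgeRepro2.BallTransitive
import Summits.Ventures.HodgeRepro2.T5BallQuotientDecomposition
import Summits.Ventures.HodgeRepro2.DefiniteUnitaryBounded
import Summits.Ventures.HodgeRepro2.IntegralUnitaryDiscrete
import Summits.Ventures.HodgeRepro2.LevelDiscrete
import Summits.Ventures.HodgeRepro2.BallStabilizerBounded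
import Summits.Ventures.HodgeRepro2.BallStabilizerCompact
import Summits.Ventures.HodgeRepro2.BallFreeAction
import Summits.Ventures.HodgeRepro2.BallMulAction
import Summits.Ventures.HodgeRepro2.BallHomogeneous

/-!
# `Γ\𝔹² ≅ Γ\G/K`: the concrete ball quotient is the double-coset model

The Tier-5 sub-step N1 (`T5BallQuotientDecomposition`, p391785) works with the abstract model
`Γ_j\G_∞/K_∞ = orbitRel.Quotient Γ_j (G_∞ ⧸ K_∞)` and its double-coset form
(`doubleCosetEquivOrbitSpace`), leaving «`Γ_j\G_∞/K_∞ → Γ_j\𝔹²`» as prose.  With the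
`U(2,1)`-equivariant bijection `𝔹² ≃ U(2,1) ⧸ K` of `BallHomogeneous.lean` this identification is
now kernel-checked:

* `ballEquivQuotientStabilizer_symm_smul` / `ballEquivQuotientStabilizer_smul` — the bijection
  `𝔹² ≃ U(2,1) ⧸ K` is `U(2,1)`-equivariant;
* `frameHom hQ S hS : S →* u21Subgroup` — the frame embedding of a subgroup `S ≤ U(H)` of `GL₃(K)`
  (`IsFrame.realEmbeddingHom`, p395424), with `frameAction_smul_eq_frameHom_smul`;
* `ballQuotientEquivOrbitSpace` — **`S\𝔹² ≃ Γ\(U(2,1) ⧸ K)`**, `Γ = frameHom '' S` the image of `S`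
  in `U(2,1)`, as orbit spaces;
* `ballQuotientEquivDoubleCoset` — **`S\𝔹² ≃ Γ\U(2,1)/K`** as a double-coset space
  (`T5BallQuotientDecomposition.doubleCosetEquivOrbitSpace`).
-/

open Matrix

namespace Summit.Ventures.HodgeRepro2.ShimuraData

/-- The stabiliser of the origin in `u21Subgroup`. -/
noncomputable abbrev originStabilizer : Subgroup u21Subgroup :=
  MulAction.stabilizer u21Subgroup ballOrigin

/-- The inverse of `ballEquivQuotientStabilizer` is equivariant. -/
theorem ballEquivQuotientStabilizer_symm_smul (g : u21Subgroup)
    (q : u21Subgroup ⧸ originStabilizer) :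
    ballEquivQuotientStabilizer.symm (g • q) = g • ballEquivQuotientStabilizer.symm q := by
  refine QuotientGroup.induction_on q fun g₀ => ?_
  apply Subtype.ext
  have h1 : ∀ g₁ : u21Subgroup,
      ((ballEquivQuotientStabilizer.symm (QuotientGroup.mk g₁ : u21Subgroup ⧸ originStabilizer) :
        ball₂) : Fin 2 → ℂ) = ((g₁ • ballOrigin : ball₂) : Fin 2 → ℂ) := fun g₁ => by
    unfold ballEquivQuotientStabilizer
    simp only [Equiv.symm_trans_apply, Equiv.symm_symm, Equiv.Set.univ_apply,
      Equiv.setCongr_symm_apply]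
    exact congrArg Subtype.val
      (MulAction.orbitEquivQuotientStabilizer_symm_apply u21Subgroup ballOrigin g₁)
  have h2 : (g • (QuotientGroup.mk g₀ : u21Subgroup ⧸ originStabilizer)) =
      QuotientGroup.mk (g * g₀) :=
    MulAction.Quotient.smul_mk _ g g₀
  have h3 : ballEquivQuotientStabilizer.symm (QuotientGroup.mk g₀ : u21Subgroup ⧸ originStabilizer) =
      g₀ • ballOrigin := Subtype.ext (h1 g₀)
  rw [h2, h1, h3, mul_smul]

/-- `ballEquivQuotientStabilizer` is equivariant. -/
theorem ballEquivQuotientStabilizer_smul (g : u21Subgroup) (z : ball₂) :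
    ballEquivQuotientStabilizer (g • z) = g • ballEquivQuotientStabilizer z := by
  apply ballEquivQuotientStabilizer.symm.injective
  rw [Equiv.symm_apply_apply, ballEquivQuotientStabilizer_symm_smul, Equiv.symm_apply_apply]

section CMField

variable {K : Type*} [Field K] [NumberField K] [NumberField.IsCMField K]

/-- The frame embedding of a subgroup `S ≤ U(H)` of `GL₃(K)` into `U(2,1)`. -/
noncomputable def frameHom {τ₁ : K →+* ℂ} {H : Matrix (Fin 3) (Fin 3) K}
    {Q : Matrix (Fin 3) (Fin 3) ℂ} (hQ : IsFrame K τ₁ H Q) (S : Subgroup (GL (Fin 3) K))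
    (hS : (S : Set (GL (Fin 3) K)) ⊆ unitaryGroup K H) : S →* u21Subgroup :=
  hQ.realEmbeddingHom.comp (Subgroup.inclusion (SetLike.coe_subset_coe.mp hS))

/-- The underlying matrix of `frameHom`. -/
theorem coe_frameHom {τ₁ : K →+* ℂ} {H : Matrix (Fin 3) (Fin 3) K}
    {Q : Matrix (Fin 3) (Fin 3) ℂ} (hQ : IsFrame K τ₁ H Q) (S : Subgroup (GL (Fin 3) K))
    (hS : (S : Set (GL (Fin 3) K)) ⊆ unitaryGroup K H) (γ : S) :
    ((frameHom hQ S hS γ : GL (Fin 3) ℂ) : Matrix (Fin 3) (Fin 3) ℂ) =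
      realEmbedding K τ₁ Q γ := by
  unfold frameHom
  rw [MonoidHom.comp_apply, hQ.coe_realEmbeddingHom]
  rfl

/-- The frame action of `S` on the ball is the `U(2,1)`-action through `frameHom`. -/
theorem frameAction_smul_eq_frameHom_smul {τ₁ : K →+* ℂ} {H : Matrix (Fin 3) (Fin 3) K}
    {Q : Matrix (Fin 3) (Fin 3) ℂ} (hQ : IsFrame K τ₁ H Q) (S : Subgroup (GL (Fin 3) K))
    (hS : (S : Set (GL (Fin 3) K)) ⊆ unitaryGroup K H) (γ : S) (z : ball₂) :
    letI := frameAction hQ S hS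
    γ • z = frameHom hQ S hS γ • z := by
  letI := frameAction hQ S hS
  apply Subtype.ext
  rw [frameAction_smul_coe, u21Action_smul_coe, coe_frameHom]

/-- **`S\𝔹² ≃ Γ\(U(2,1) ⧸ K)`** as orbit spaces, `Γ = frameHom '' S`. -/
noncomputable def ballQuotientEquivOrbitSpace {τ₁ : K →+* ℂ} {H : Matrix (Fin 3) (Fin 3) K}
    {Q : Matrix (Fin 3) (Fin 3) ℂ} (hQ : IsFrame K τ₁ H Q) (S : Subgroup (GL (Fin 3) K))
    (hS : (S : Set (GL (Fin 3) K)) ⊆ unitaryGroup K H) :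
    ballQuotient hQ S hS ≃
      MulAction.orbitRel.Quotient (frameHom hQ S hS).range (u21Subgroup ⧸ originStabilizer) := by
  letI := frameAction hQ S hS
  refine Quotient.congr ballEquivQuotientStabilizer fun z z' => ?_
  rw [MulAction.orbitRel_apply, MulAction.orbitRel_apply, MulAction.mem_orbit_iff,
    MulAction.mem_orbit_iff]
  constructor
  · rintro ⟨γ, hγ⟩
    refine ⟨⟨frameHom hQ S hS γ, MonoidHom.mem_range.mpr ⟨γ, rfl⟩⟩, ?_⟩
    show frameHom hQ S hS γ • ballEquivQuotientStabilizer z' = ballEquivQuotientStabilizer z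
    rw [← ballEquivQuotientStabilizer_smul, ← frameAction_smul_eq_frameHom_smul, hγ]
  · rintro ⟨⟨s, hs⟩, hsz⟩
    obtain ⟨γ, rfl⟩ := MonoidHom.mem_range.mp hs
    have hsz' : frameHom hQ S hS γ • ballEquivQuotientStabilizer z' =
        ballEquivQuotientStabilizer z := hsz
    refine ⟨γ, ballEquivQuotientStabilizer.injective ?_⟩
    rw [frameAction_smul_eq_frameHom_smul, ballEquivQuotientStabilizer_smul]
    exact hsz'

/-- **`S\𝔹² ≃ Γ\U(2,1)/K`** as a double-coset space (the model of the Tier-5 sub-step N1). -/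
noncomputable def ballQuotientEquivDoubleCoset {τ₁ : K →+* ℂ} {H : Matrix (Fin 3) (Fin 3) K}
    {Q : Matrix (Fin 3) (Fin 3) ℂ} (hQ : IsFrame K τ₁ H Q) (S : Subgroup (GL (Fin 3) K))
    (hS : (S : Set (GL (Fin 3) K)) ⊆ unitaryGroup K H) :
    ballQuotient hQ S hS ≃
      DoubleCoset.Quotient ((frameHom hQ S hS).range : Set u21Subgroup)
        (originStabilizer : Set u21Subgroup) :=
  (ballQuotientEquivOrbitSpace hQ S hS).trans
    (T5BallQuotientDecomposition.doubleCosetEquivOrbitSpace (frameHom hQ S hS).range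
      originStabilizer).symm

end CMField

end Summit.Ventures.HodgeRepro2.ShimuraData
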